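/-
Copyright (c) 2026 the pub-hodgecm-mathlib formalisation cell (harness21).  Prover seat hodgecm-mathlib-F0P2-p06 (g22): E1 row 61-σ «THE INDUCING LINE OF `i_G(χ)`» (the σ-line
binders `hσχ hNχ hχo` + `hτsm` of ★ 61-G for row 61 ED. 2; E1 keeper ∕ dealer F0P3a-p03 (g30) «= 61-σ is yours, last hand» 04:44:03Z), 2026-09-03.
-/
import Literature.NumberTheory.Automorphic.SchneiderStuhlerEPInducedTraceDockAdapters   -- ★ (M4) p853555 (F0P3a-p04): `isOpen_ker_of_continuous_coe`
import Literature.NumberTheory.Automorphic.VanDijkTraceParabolicIndGLProof              -- ★ `continuous_rootDeltaChar_unitsCoe'`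
import Literature.NumberTheory.Automorphic.CMPrincipalSeriesJacquetEvalOne              -- ★ `continuous_proj_borelTriple`, `nonarchimedeanGroup_unitaryGroupOfForm_local`
import Literature.NumberTheory.Automorphic.CompactOpenAveragingExact                    -- ★ `isSmooth_of_forall_apply_eq_self`
import Summits.HodgeConjecture.HodgeConjecture.Theorems.F0P2nBorelCharactersUnipotent     -- ★ `map_eq_one_of_mem_cmUnipotentU` (every character of `B(L⁺_v)` kills `N`)
import HarnessLib

/-!
# F0 · P3c · «StCharTS» — E1 ROW 61-σ: THE INDUCING LINE `δ_B^{1∕2} ⊗ χ` OF THE PRINCIPAL SERIES `i_G(χ)` — the σ-line binders of ★ 61-G at the datum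

Cell `pub/hodgecm-mathlib` (D-0151), crux H413 = `stmt-HodgeConjecture-24833`, lane `--supports … --as helper`, route HCCMUnconditional; E1 row 61-σ (last hand of seat F0P2-p06
(g22)).  THEOREMS ONLY (no definition, no instance, no notation, no named fact, no `sorry`).

THE LINE.  `i_G(χ) = cmPrincipalSeries L 3 v χ = Ind_B^G σχ` with `σχ := twist ((((trivial ℂ T ℂ).twist χ).comp t.proj)) (rootDeltaChar t.P)` on `W = ℂ` (`t = cmBorelTriple L 3 v`,
`B = t.P = T N`).  ★ 61-G `Representation.finrank_intertwiningMap_smoothIndRep_eq_sum_block_eigen_zeroChains ∕ _oneChains` takes the inducing line through the binders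
`(σ : Representation k ↥t.P W) (χH : ↥t.P →* kˣ) (hσχ : σ h w = χH h • w) (hχo : IsOpen ↑χH.ker) (hNχ : n ∈ t.N → χH ⟨n, _⟩ = 1) (hW1 : finrank k W = 1)` and the `K`-type through
`(hτsm : τK.IsSmooth)`.  This file discharges them, with `χH := rootDeltaChar t.P * χ.comp t.proj`:
* §1 (GENERIC parabolic triple `t` of a topological group, `χ : ↥t.M →* ℂˣ`): `twist_trivial_twist_comp_proj_apply` (= `hσχ`), `rootDeltaChar_mul_comp_proj_eq_one_of_mem_N` (= `hNχ`
  from `δ_P|_N = 1`), `isOpen_ker_rootDeltaChar_mul_comp_proj` (= `hχo` from `Continuous χ`, `Continuous t.proj`, ★ (M4) `isOpen_ker_of_continuous_coe` — `ℂˣ` has no small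
  subgroups), `isSmooth_of_apply_eq_one_of_le` (= `hτsm`: a representation of `↥K` trivial on an OPEN `U ≤ K` is smooth); `hW1` is Mathlib's `Module.finrank_self`.
* §2 (THE DATUM `t = cmBorelTriple L 3 v`, on the matrix carrier `U(Φ₃)(L⁺_v)` where `cmPrincipalSeries` lives): `cmBorel_line_apply`, `cmBorel_lineChar_eq_one_of_mem_N` (★ J2b
  `map_eq_one_of_mem_cmUnipotentU`: EVERY character of `B(L⁺_v)` kills `N(L⁺_v)`), `isOpen_ker_cmBorel_lineChar` (★ `continuous_proj_borelTriple`, ★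
  `nonarchimedeanGroup_unitaryGroupOfForm_local`).
* §3 (β) THE CARRIER BRIDGE `smoothIndRep_cmBorel_eq_cmPrincipalSeries`: on the `Gqs L v` reading `(cmBorelTriple L 3 v : ParabolicTriple (Gqs L v))` (★ 55-B's convention),
  `smoothIndRep B σχ = (cmPrincipalSeries L 3 v χ : Representation ℂ (Gqs L v) _)` by `rfl` at DEFAULT heartbeats (isolated; never inline it in a larger term — inside an
  `IntertwiningMap` type the same unfolding cost ★ `F0P2nFrobeniusCmPrincipalSeries` 8 M heartbeats).
HONEST LABEL: count-neutral datum helpers; E1 = PRINT; h413 OPEN; HC_CM is proved only modulo the 7 printed citations (2 remaining named inputs: hLiu418 = `stmt-HodgeConjecture-24832`,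
h413 = `stmt-HodgeConjecture-24833`) until rung 0 closes.

## References
* [BernsteinZelevinsky1977] I. N. Bernstein, A. V. Zelevinsky, *Induced representations of reductive 𝔭-adic groups I*, Ann. Sci. ÉNS 10 (1977), 1.7–1.8, §2.3.
* [Rogawski1990] J. D. Rogawski, *Automorphic Representations of Unitary Groups in Three Variables* (1990), §1.10 p. 9; §12.1 p. 171; §12.2 p. 173.
* [Casselman1995] W. Casselman, *Introduction to the theory of admissible representations of `p`-adic reductive groups* (1995 notes), §2.2, §3.1.
* [BernsteinZelevinsky1976] I. N. Bernstein, A. V. Zelevinsky, *Representations of the group `GL(n,F)`*, Russian Math. Surveys 31 (1976), §2.1.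
-/

set_option autoImplicit false

set_option linter.dupNamespace false

open NumberField IsDedekindDomain
open Literature.NumberTheory.Rogawski1990 Literature.NumberTheory.Automorphic Literature.NumberTheory.Automorphic.UnitaryGroup

namespace Summit.HodgeConjecture.HodgeConjecture.Cruxes.H413.F0P3cStCharTSPrincipalSeriesLine

open Summit.HodgeConjecture.HodgeConjecture.Cruxes.H413

/-! ## §1 Generic: the line `δ_P^{1∕2} ⊗ (χ ∘ proj)` of a parabolic triple -/

section Generic

variable {G : Type*} [Group G] [TopologicalSpace G] [IsTopologicalGroup G] (t : ParabolicTriple G) [LocallyCompactSpace ↥t.P] (χ : ↥t.M →* ℂˣ)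

/-- **`hσχ`: the inducing line acts by the character `χH := δ_P^{1∕2} · (χ ∘ proj)`**: `σχ h w = χH h • w` for
`σχ = twist ((((trivial ℂ M ℂ).twist χ).comp proj)) (rootDeltaChar P)`. [cite: BernsteinZelevinsky1977, 1.8, §2.3] [cite: Rogawski1990, §12.1 p. 171] -/
theorem twist_trivial_twist_comp_proj_apply (h : ↥t.P) (w : ℂ) :
    Representation.twist ((((Representation.trivial ℂ ↥t.M ℂ).twist χ).comp t.proj)) (rootDeltaChar t.P) h w =
      (((rootDeltaChar t.P * χ.comp t.proj) h : ℂˣ) : ℂ) • w := by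
  rw [Representation.twist_apply, MonoidHom.mul_apply, Units.val_mul, mul_smul]
  rfl

omit [TopologicalSpace G] [IsTopologicalGroup G] in
/-- **`hNχ`: `χH = δ_P^{1∕2} · (χ ∘ proj)` is trivial on `N`** when `δ_P|_N = 1` (`hδ`, the hypothesis of ★ `Representation.frobenius_normalizedInd`; `proj|_N = 1` by ★
`ParabolicTriple.proj_apply_of_mem_N`). [cite: BernsteinZelevinsky1977, 1.8] -/
theorem rootDeltaChar_mul_comp_proj_eq_one_of_mem_N [TopologicalSpace G] [IsTopologicalGroup G] [LocallyCompactSpace ↥t.P]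
    (hδ : ∀ (n : G) (hn : n ∈ t.N), deltaChar t.P ⟨n, t.N_le hn⟩ = 1)
    (n : G) (hnP : n ∈ t.P) (hnN : n ∈ t.N) : (rootDeltaChar t.P * χ.comp t.proj) ⟨n, hnP⟩ = 1 := by
  rw [MonoidHom.mul_apply, MonoidHom.comp_apply, t.proj_apply_of_mem_N ⟨n, hnP⟩ hnN, map_one, mul_one]
  exact rootDeltaChar_eq_one_of_deltaChar_eq_one _ (hδ n hnN)

end Generic

section OpenKernel

variable {G : Type*} [Group G] [TopologicalSpace G] [NonarchimedeanGroup G] (t : ParabolicTriple G) [LocallyCompactSpace ↥t.P] (χ : ↥t.M →* ℂˣ)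

/-- **`hχo`: the kernel of `χH = δ_P^{1∕2} · (χ ∘ proj)` is open** when `χ` is continuous (as a `ℂ`-valued map) and the Levi projection is continuous: `χH` is then continuous
into `ℂ`, and a continuous homomorphism from a subgroup of a nonarchimedean group to `ℂˣ` has open kernel (★ (M4) `isOpen_ker_of_continuous_coe`: `ℂˣ` has no small subgroups).
[cite: BernsteinZelevinsky1977, 1.7–1.8] [cite: Casselman1995, §3.1] -/
theorem isOpen_ker_rootDeltaChar_mul_comp_proj
    (hproj : Continuous t.proj) (hχ : Continuous fun m : ↥t.M => ((χ m : ℂˣ) : ℂ)) :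
    IsOpen ((rootDeltaChar t.P * χ.comp t.proj).ker : Set ↥t.P) := by
  borelize ↥t.P
  refine Representation.isOpen_ker_of_continuous_coe t.P _ ?_
  have h : (fun b : ↥t.P => (((rootDeltaChar t.P * χ.comp t.proj) b : ℂˣ) : ℂ)) =
      fun b => ((rootDeltaChar t.P b : ℂˣ) : ℂ) * ((χ (t.proj b) : ℂˣ) : ℂ) := by
    funext b
    rw [MonoidHom.mul_apply, MonoidHom.comp_apply, Units.val_mul]
  rw [h]
  exact (continuous_rootDeltaChar_unitsCoe' t.P).mul (hχ.comp hproj)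

end OpenKernel

section KType

variable {k G W : Type*} [Field k] [CharZero k] [Group G] [TopologicalSpace G] [IsTopologicalGroup G] [AddCommGroup W] [Module k W]

omit [CharZero k] in
/-- **`hτsm`: a representation of `↥K` trivial on an OPEN subgroup `U ≤ K` of `G` is smooth** (★ `isSmooth_of_forall_apply_eq_self` at `T := U` read in `↥K`; at the datum `K = P_F`
the facet stabiliser, `U = U_F` its level group, `τK = ρ|_K` on `V^{U_F}`). [cite: BernsteinZelevinsky1976, §2.1] [cite: Casselman1995, §2.2] -/
theorem isSmooth_of_apply_eq_one_of_le {U K : Subgroup G} (hUK : U ≤ K) (hUo : IsOpen (U : Set G)) (τ : Representation k ↥K W)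
    (hτ : ∀ (u : G) (hu : u ∈ U), τ ⟨u, hUK hu⟩ = 1) : τ.IsSmooth := by
  refine Representation.isSmooth_of_forall_apply_eq_self τ (T := U.subgroupOf K) ?_ fun u hu w => ?_
  · rw [Subgroup.coe_subgroupOf]
    exact hUo.preimage continuous_subtype_val
  · have h := hτ (u : G) (Subgroup.mem_subgroupOf.1 hu)
    rw [Subtype.coe_eta] at h
    rw [h, Module.End.one_apply]

end KType

/-! ## §2 The datum: the Borel `B(L⁺_v)` of `U(Φ₃)(L⁺_v)` -/

section Datum

variable (L : Type) [Field L] [NumberField L] [IsCMField L] (v : HeightOneSpectrum (𝓞 ↥(maximalRealSubfield L)))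

/-- **`hσχ` AT THE DATUM**: the inducing line of `i_G(χ) = cmPrincipalSeries L 3 v χ` acts by `χH := δ_B^{1∕2} · (χ ∘ proj)` (§1 at `t := cmBorelTriple L 3 v`).
[cite: Rogawski1990, §12.1 p. 171; §12.2 p. 173] [cite: BernsteinZelevinsky1977, §2.3] -/
theorem cmBorel_line_apply (χ : ↥(cmBorelTriple L 3 v).M →* ℂˣ) (h : ↥(cmBorelTriple L 3 v).P) (w : ℂ) :
    haveI := locallyCompactSpace_cmBorelU L 3 v
    Representation.twist ((((Representation.trivial ℂ ↥(cmBorelTriple L 3 v).M ℂ).twist χ).comp (cmBorelTriple L 3 v).proj)) (rootDeltaChar (cmBorelTriple L 3 v).P) h w =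
      (((rootDeltaChar (cmBorelTriple L 3 v).P * χ.comp (cmBorelTriple L 3 v).proj) h : ℂˣ) : ℂ) • w :=
  haveI := locallyCompactSpace_cmBorelU L 3 v
  twist_trivial_twist_comp_proj_apply (cmBorelTriple L 3 v) χ h w

/-- **`hNχ` AT THE DATUM**: `χH = δ_B^{1∕2} · (χ ∘ proj)` kills `N(L⁺_v)` — indeed EVERY character of `B(L⁺_v)` does (★ J2b `map_eq_one_of_mem_cmUnipotentU`).
[cite: Rogawski1990, §1.10 p. 9] [cite: BernsteinZelevinsky1977, 1.8] -/
theorem cmBorel_lineChar_eq_one_of_mem_N (χ : ↥(cmBorelTriple L 3 v).M →* ℂˣ)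
    (n : ↥(unitaryGroupOfForm (conjLocal L (IsCMField.complexConj L) v) (cmLocalForm L 3 v))) (hnP : n ∈ (cmBorelTriple L 3 v).P) (hnN : n ∈ (cmBorelTriple L 3 v).N) :
    haveI := locallyCompactSpace_cmBorelU L 3 v
    (rootDeltaChar (cmBorelTriple L 3 v).P * χ.comp (cmBorelTriple L 3 v).proj) ⟨n, hnP⟩ = 1 :=
  haveI := locallyCompactSpace_cmBorelU L 3 v
  F0P2nBorelCharactersUnipotent.map_eq_one_of_mem_cmUnipotentU L v _ hnN

/-- **`hχo` AT THE DATUM**: for a continuous `χ` of the diagonal torus `T(L⁺_v)`, the kernel of `χH = δ_B^{1∕2} · (χ ∘ proj)` is open in `B(L⁺_v)` (§1 with ★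
`continuous_proj_borelTriple` and the nonarchimedean structure of `U(Φ₃)(L⁺_v)`, ★ `nonarchimedeanGroup_unitaryGroupOfForm_local`).
[cite: BernsteinZelevinsky1977, 1.7–1.8] [cite: Casselman1995, §3.1] -/
theorem isOpen_ker_cmBorel_lineChar (χ : ↥(cmBorelTriple L 3 v).M →* ℂˣ) (hχ : Continuous fun m : ↥(cmBorelTriple L 3 v).M => ((χ m : ℂˣ) : ℂ)) :
    haveI := locallyCompactSpace_cmBorelU L 3 v
    IsOpen ((rootDeltaChar (cmBorelTriple L 3 v).P * χ.comp (cmBorelTriple L 3 v).proj).ker : Set ↥(cmBorelTriple L 3 v).P) := by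
  haveI := locallyCompactSpace_cmBorelU L 3 v
  haveI : NonarchimedeanGroup ↥(unitaryGroupOfForm (conjLocal L (IsCMField.complexConj L) v) (cmLocalForm L 3 v)) :=
    nonarchimedeanGroup_unitaryGroupOfForm_local (E := L) (c := IsCMField.complexConj L) (N := 3) (v := v) (J' := cmLocalForm L 3 v)
  exact isOpen_ker_rootDeltaChar_mul_comp_proj (cmBorelTriple L 3 v) χ
    (continuous_proj_borelTriple (conjLocal L (IsCMField.complexConj L) v) (cmLocalForm L 3 v) (cmLocalForm_eq_over L 3 v)) hχ

/-! ## §3 The carrier bridge: `i_G(χ)` read on `Gqs L v` IS the smooth induction of the line from `B` (definitional) -/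

/-- **(β) THE CARRIER BRIDGE**: on the `Gqs L v` reading of the Borel triple (★ 55-B's convention `(cmBorelTriple L 3 v : ParabolicTriple (Gqs L v))`),
`Ind_B^G σχ = smoothIndRep B σχ` IS `cmPrincipalSeries L 3 v χ` — definitionally (`cmPrincipalSeries ↦ principalSeries ↦ normalizedInd ↦ smoothIndRep`); `rfl` at DEFAULT
heartbeats in this isolated shape (measured 13 s; contrast ★ `F0P2nFrobeniusCmPrincipalSeries`, where the same unfolding inside an `IntertwiningMap` type cost 8 M).  Row 61 ED. 2
rewrites ★ 61-G's `smoothIndRep t.P σ` into ★ 61a ED. 1's `(cmPrincipalSeries L 3 v χ : Representation ℂ (Gqs L v) _)` with it (after `subst ht`).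
[cite: Rogawski1990, §12.2 p. 173] [cite: BernsteinZelevinsky1977, §2.3] -/
theorem smoothIndRep_cmBorel_eq_cmPrincipalSeries (χ : ↥(cmBorelTriple L 3 v).M →* ℂˣ) :
    haveI : LocallyCompactSpace ↥(cmBorelTriple L 3 v : ParabolicTriple (Gqs L v)).P := locallyCompactSpace_cmBorelU L 3 v
    Representation.smoothIndRep (cmBorelTriple L 3 v : ParabolicTriple (Gqs L v)).P
        (Representation.twist ((((Representation.trivial ℂ ↥(cmBorelTriple L 3 v : ParabolicTriple (Gqs L v)).M ℂ).twist χ).comp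
          (cmBorelTriple L 3 v : ParabolicTriple (Gqs L v)).proj)) (rootDeltaChar (cmBorelTriple L 3 v : ParabolicTriple (Gqs L v)).P)) =
      (UnitaryGroup.cmPrincipalSeries L 3 v χ : Representation ℂ (Gqs L v) _) := by
  rfl

end Datum

end Summit.HodgeConjecture.HodgeConjecture.Cruxes.H413.F0P3cStCharTSPrincipalSeriesLine
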